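import Literature.NumberTheory.Sieve.VinogradovExpSumTools

/-!
# Route `GreenTaoLevelTwo`, crux `MNTwo` (stmt-Parity-21276), line `birth`, stub `stub_mnVertical`:
# from a large quadrilinear phase sum to many small `‖c l₁l₂m₁‖` (GT 2008b §10, proof of Lemma 24)

Tool for block V4 / H3 (= AIF §10 Lemma 24 "Type II sum implies major arc") of the
`stub_mnVertical` census (B. Green, T. Tao, *Quadratic uniformity of the Möbius function*, Ann.
Inst. Fourier 58 (2008) = arXiv:math/0606087, §10, proof of Lemma 24: "By the pigeonhole principle,
we can thus find `l₁', l₂' = O(L)` and `m₁', m₂' = O(M)` such that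
`|∑ e(2(l₁−l₁')(l₂−l₂')(m₁−m₁')(m₂−m₂')φ''(st,st))| ≳ L²M²`.  Summing in `m₂` using
(exponential-sum), we obtain `∑_{l₁,l₂,m₁} min(1, (M‖…‖)⁻¹) ≳ L²M` … which means that
`‖l₁l₂m₁φ''(st,st)‖ ≲ 1/M` for those triples").  Def-free, explicit: the input is the real part
of the eightfold sum produced by `…MNTwoBoxPhase.norm_pow_sixteen_quadrilinear_le`, the output a
lower bound for the number of triples `(l₁,l₂,m₁)` with `‖c(l₁−l₁')(l₂−l₂')(m₁−m₁')‖_{ℝ/ℤ} ≤ 1/(κN)`.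

* `exists_div_card_le_of_le_sum` — pigeonhole on a sum;
* `sum_comm₃`, `sum_comm₄`, `sum_comm₅` — moving the innermost sum outermost;
* `norm_sum_Icc_int_fourierChar_le_geomBound` — the geometric-series bound on a `ℤ`-interval;
* `card_filter_ge_of_sum_le` — counting from a sum of bounded nonnegative terms;
* `many_small_triples` — the step quoted above.

References: [GreenTao2008QuadraticMobius] arXiv:math/0606087 §10 (proof of Lemma 24), App. A
eq. (exponential-sum).
-/

noncomputable section

open Finset
open scoped FourierTransform

namespace Summit.Parity.GeneralizedHardyLittlewood.GreenTaoLevelTwoMNTwoQuadrilinearCount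

open Literature.NumberTheory.Sieve.Vinogradov (distInt distInt_nonneg geomBound geomBound_le
  geomBound_le_inv geomBound_nonneg norm_sum_Icc_fourierChar_le_geomBound norm_fourierChar)

variable {α β γ δ ε : Type*}

/-- Pigeonhole: if `X ≤ ∑_{a ∈ s} g(a)` and `s ≠ ∅` then some `g(a) ≥ X/#s`. [folklore] -/
theorem exists_div_card_le_of_le_sum (s : Finset α) (hs : s.Nonempty) (g : α → ℝ) {X : ℝ}
    (h : X ≤ ∑ a ∈ s, g a) : ∃ a ∈ s, X / #s ≤ g a := by
  by_contra hc
  push Not at hc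
  have hlt : ∑ a ∈ s, g a < ∑ _a ∈ s, X / #s := Finset.sum_lt_sum_of_nonempty hs fun a ha => hc a ha
  rw [Finset.sum_const, nsmul_eq_mul, mul_div_cancel₀ _ (by
    have := hs.card_pos; exact_mod_cast this.ne')] at hlt
  linarith

/-- `∑_x ∑_y ∑_z F = ∑_z ∑_x ∑_y F`. [folklore] -/
theorem sum_comm₃ (s : Finset α) (t : Finset β) (u : Finset γ) (F : α → β → γ → ℂ) :
    ∑ x ∈ s, ∑ y ∈ t, ∑ z ∈ u, F x y z = ∑ z ∈ u, ∑ x ∈ s, ∑ y ∈ t, F x y z := by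
  rw [Finset.sum_congr rfl fun x _ => Finset.sum_comm (f := F x), Finset.sum_comm]

/-- `∑_x ∑_y ∑_z ∑_w F = ∑_w ∑_x ∑_y ∑_z F`. [folklore] -/
theorem sum_comm₄ (s : Finset α) (t : Finset β) (u : Finset γ) (v : Finset δ)
    (F : α → β → γ → δ → ℂ) :
    ∑ x ∈ s, ∑ y ∈ t, ∑ z ∈ u, ∑ w ∈ v, F x y z w =
      ∑ w ∈ v, ∑ x ∈ s, ∑ y ∈ t, ∑ z ∈ u, F x y z w := by
  rw [Finset.sum_congr rfl fun x _ => sum_comm₃ t u v (F x), Finset.sum_comm]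

/-- `∑_x ∑_y ∑_z ∑_w ∑_r F = ∑_r ∑_x ∑_y ∑_z ∑_w F`. [folklore] -/
theorem sum_comm₅ (s : Finset α) (t : Finset β) (u : Finset γ) (v : Finset δ) (o : Finset ε)
    (F : α → β → γ → δ → ε → ℂ) :
    ∑ x ∈ s, ∑ y ∈ t, ∑ z ∈ u, ∑ w ∈ v, ∑ r ∈ o, F x y z w r =
      ∑ r ∈ o, ∑ x ∈ s, ∑ y ∈ t, ∑ z ∈ u, ∑ w ∈ v, F x y z w r := by
  rw [Finset.sum_congr rfl fun x _ => sum_comm₄ t u v o (F x), Finset.sum_comm]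

/-- **(exponential-sum) on a `ℤ`-interval**: `‖∑_{m ∈ [a,b]} e(xm)‖ ≤ min(V, 1/(2‖x‖))` (in the
`geomBound` convention) whenever `b − a + 1 ≤ V`, `a ≤ b`.
[cite: GreenTao2008QuadraticMobius, App. A eq. (exponential-sum)] -/
theorem norm_sum_Icc_int_fourierChar_le_geomBound {a b : ℤ} (hab : a ≤ b) (x : ℝ) {V : ℝ}
    (hV : ((b - a + 1 : ℤ) : ℝ) ≤ V) :
    ‖∑ m ∈ Icc a b, (𝐞 (x * m) : ℂ)‖ ≤ geomBound V x := by
  set k : ℕ := (b - a + 1).toNat with hk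
  have hk' : ((k : ℕ) : ℤ) = b - a + 1 := Int.toNat_of_nonneg (by omega)
  -- reindex `[a,b] = {a - 1 + n : 1 ≤ n ≤ k}`
  set emb : ℕ ↪ ℤ := ⟨fun n => a - 1 + n, fun n n' h => by simpa using h⟩ with hemb
  have hmap : (Icc 1 k).map emb = Icc a b := by
    ext m
    simp only [Finset.mem_map, Finset.mem_Icc, hemb, Function.Embedding.coeFn_mk]
    constructor
    · rintro ⟨n, ⟨h1, h2⟩, rfl⟩
      constructor <;> omega
    · rintro ⟨h1, h2⟩
      exact ⟨(m - a + 1).toNat, ⟨by omega, by omega⟩, by omega⟩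
  rw [← hmap, Finset.sum_map]
  have hterm : ∀ n : ℕ, (𝐞 (x * (emb n : ℤ)) : ℂ) =
      (𝐞 (x * ((a : ℝ) - 1)) : ℂ) * (𝐞 ((n : ℝ) * x) : ℂ) := by
    intro n
    simp only [hemb, Function.Embedding.coeFn_mk]
    rw [← Circle.coe_mul, ← AddChar.map_add_eq_mul]
    congr 2
    push_cast
    ring
  rw [Finset.sum_congr rfl fun n _ => hterm n, ← Finset.mul_sum, norm_mul, norm_fourierChar,
    one_mul]
  refine norm_sum_Icc_fourierChar_le_geomBound x ?_
  have : (k : ℝ) = ((b - a + 1 : ℤ) : ℝ) := by exact_mod_cast hk'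
  rw [this]; exact hV

/-- **Counting from a bounded sum**: if `g ≤ V` on `P` and `Y ≤ ∑_P g`, then at least
`(Y − θ·#P)/V` elements `p ∈ P` have `g(p) ≥ θ` (`θ ≥ 0`). [folklore] -/
theorem card_filter_ge_of_sum_le (P : Finset α) (g : α → ℝ) {V Y θ : ℝ} (hV : 0 < V)
    (hθ : 0 ≤ θ) (hgV : ∀ p ∈ P, g p ≤ V) (h : Y ≤ ∑ p ∈ P, g p) :
    (Y - θ * #P) / V ≤ #(P.filter fun p => θ ≤ g p) := by
  classical
  rw [div_le_iff₀ hV]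
  have hsplit := Finset.sum_filter_add_sum_filter_not P (fun p => θ ≤ g p) g
  have h1 : ∑ p ∈ P.filter (fun p => θ ≤ g p), g p ≤ #(P.filter fun p => θ ≤ g p) * V := by
    calc ∑ p ∈ P.filter (fun p => θ ≤ g p), g p ≤ ∑ _p ∈ P.filter (fun p => θ ≤ g p), V :=
          Finset.sum_le_sum fun p hp => hgV p (Finset.mem_filter.mp hp).1
      _ = _ := by rw [Finset.sum_const, nsmul_eq_mul]
  have h2 : ∑ p ∈ P.filter (fun p => ¬ θ ≤ g p), g p ≤ θ * #P := by
    calc ∑ p ∈ P.filter (fun p => ¬ θ ≤ g p), g p ≤ ∑ _p ∈ P.filter (fun p => ¬ θ ≤ g p), θ :=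
          Finset.sum_le_sum fun p hp => (not_le.mp (Finset.mem_filter.mp hp).2).le
      _ = #(P.filter fun p => ¬ θ ≤ g p) * θ := by rw [Finset.sum_const, nsmul_eq_mul]
      _ ≤ #P * θ :=
          mul_le_mul_of_nonneg_right (by exact_mod_cast Finset.card_filter_le _ _) hθ
      _ = θ * #P := mul_comm _ _
  linarith

set_option maxHeartbeats 400000 in
/-- **Many small triples (GT 2008b §10, Lemma 24, the step after the box Cauchy–Schwarz).**
Let `S₁, S₂, T₁ ⊂ ℤ` be finite nonempty, `T₂ = [a,b]` a `ℤ`-interval with `N = #[a,b]` elements,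
`κ > 0`, and suppose
`κ (#S₁)²(#S₂)²(#T₁)² N² ≤ Re ∑_{l₁,l₁',l₂,l₂',m₁,m₁',m₂,m₂'} e(c(l₁−l₁')(l₂−l₂')(m₁−m₁')(m₂−m₂'))`.
Then for some `l₁' ∈ S₁`, `l₂' ∈ S₂`, `m₁' ∈ T₁`, at least `(κ/2)·#S₁·#S₂·#T₁` triples
`(l₁,l₂,m₁) ∈ S₁ × S₂ × T₁` satisfy `‖c(l₁−l₁')(l₂−l₂')(m₁−m₁')‖_{ℝ/ℤ} ≤ 1/(κN)`.
[cite: GreenTao2008QuadraticMobius, §10 (proof of Lemma 24)] -/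
theorem many_small_triples {S₁ S₂ T₁ : Finset ℤ} {a b : ℤ} (hab : a ≤ b) (c : ℝ) {κ : ℝ}
    (hκ : 0 < κ) (hS₁ : S₁.Nonempty) (hS₂ : S₂.Nonempty) (hT₁ : T₁.Nonempty)
    (h : κ * (#S₁ : ℝ) ^ 2 * (#S₂ : ℝ) ^ 2 * (#T₁ : ℝ) ^ 2 * (#(Icc a b) : ℝ) ^ 2 ≤
      (∑ l₁ ∈ S₁, ∑ l₁' ∈ S₁, ∑ l₂ ∈ S₂, ∑ l₂' ∈ S₂, ∑ m₁ ∈ T₁, ∑ m₁' ∈ T₁,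
        ∑ m₂ ∈ Icc a b, ∑ m₂' ∈ Icc a b,
          (𝐞 (c * (l₁ - l₁') * (l₂ - l₂') * (m₁ - m₁') * (m₂ - m₂')) : ℂ)).re) :
    ∃ l₁' ∈ S₁, ∃ l₂' ∈ S₂, ∃ m₁' ∈ T₁,
      κ / 2 * #S₁ * #S₂ * #T₁ ≤ #(((S₁ ×ˢ S₂) ×ˢ T₁).filter fun p =>
        distInt (c * (p.1.1 - l₁') * (p.1.2 - l₂') * (p.2 - m₁')) ≤ 1 / (κ * #(Icc a b))) := by
  classical
  -- sizes
  have hN₁0 : (0 : ℝ) < #S₁ := by exact_mod_cast hS₁.card_pos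
  have hN₂0 : (0 : ℝ) < #S₂ := by exact_mod_cast hS₂.card_pos
  have hN₃0 : (0 : ℝ) < #T₁ := by exact_mod_cast hT₁.card_pos
  have hT₂ : (Icc a b).Nonempty := ⟨a, by rw [Finset.mem_Icc]; exact ⟨le_rfl, hab⟩⟩
  have hN0 : (0 : ℝ) < #(Icc a b) := by exact_mod_cast hT₂.card_pos
  have hNeq : (#(Icc a b) : ℝ) = ((b - a + 1 : ℤ) : ℝ) := by
    rw [Int.card_Icc]
    have : (((b + 1 - a).toNat : ℕ) : ℤ) = b - a + 1 := by
      rw [Int.toNat_of_nonneg (by omega)]; ring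
    exact_mod_cast this
  -- the phase, as an opaque function
  obtain ⟨Φ, hΦ⟩ : ∃ Φ : ℤ → ℤ → ℤ → ℤ → ℤ → ℤ → ℤ → ℤ → ℂ,
      Φ = fun (l₁ l₁' l₂ l₂' m₁ m₁' m₂ m₂' : ℤ) =>
        (𝐞 (c * (l₁ - l₁') * (l₂ - l₂') * (m₁ - m₁') * (m₂ - m₂')) : ℂ) := ⟨_, rfl⟩
  have h' : κ * (#S₁ : ℝ) ^ 2 * (#S₂ : ℝ) ^ 2 * (#T₁ : ℝ) ^ 2 * (#(Icc a b) : ℝ) ^ 2 ≤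
      (∑ l₁ ∈ S₁, ∑ l₁' ∈ S₁, ∑ l₂ ∈ S₂, ∑ l₂' ∈ S₂, ∑ m₁ ∈ T₁, ∑ m₁' ∈ T₁,
        ∑ m₂ ∈ Icc a b, ∑ m₂' ∈ Icc a b, Φ l₁ l₁' l₂ l₂' m₁ m₁' m₂ m₂').re := by
    rw [hΦ]; exact h
  clear h
  -- Stage 1: fix `l₁'`
  rw [Finset.sum_comm, Complex.re_sum] at h'
  obtain ⟨l₁', hl₁', h₁⟩ := exists_div_card_le_of_le_sum S₁ hS₁ _ h'
  -- Stage 2: fix `l₂'`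
  rw [sum_comm₃ S₁ S₂ S₂ (fun l₁ l₂ l₂' => ∑ m₁ ∈ T₁, ∑ m₁' ∈ T₁,
      ∑ m₂ ∈ Icc a b, ∑ m₂' ∈ Icc a b, Φ l₁ l₁' l₂ l₂' m₁ m₁' m₂ m₂'), Complex.re_sum] at h₁
  obtain ⟨l₂', hl₂', h₂⟩ := exists_div_card_le_of_le_sum S₂ hS₂ _ h₁
  -- Stage 3: fix `m₁'`
  rw [sum_comm₄ S₁ S₂ T₁ T₁ (fun l₁ l₂ m₁ m₁' =>
      ∑ m₂ ∈ Icc a b, ∑ m₂' ∈ Icc a b, Φ l₁ l₁' l₂ l₂' m₁ m₁' m₂ m₂'), Complex.re_sum] at h₂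
  obtain ⟨m₁', hm₁', h₃⟩ := exists_div_card_le_of_le_sum T₁ hT₁ _ h₂
  -- Stage 4: fix `m₂'`
  rw [sum_comm₅ S₁ S₂ T₁ (Icc a b) (Icc a b) (fun l₁ l₂ m₁ m₂ m₂' =>
      Φ l₁ l₁' l₂ l₂' m₁ m₁' m₂ m₂'), Complex.re_sum] at h₃
  obtain ⟨m₂', -, h₄⟩ := exists_div_card_le_of_le_sum (Icc a b) hT₂ _ h₃
  -- `h₄ : κ #S₁ #S₂ #T₁ N ≤ Re ∑_{l₁,l₂,m₁} ∑_{m₂} Φ`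
  have hX : κ * (#S₁ : ℝ) ^ 2 * (#S₂ : ℝ) ^ 2 * (#T₁ : ℝ) ^ 2 * (#(Icc a b) : ℝ) ^ 2 /
      #S₁ / #S₂ / #T₁ / #(Icc a b) = κ * #S₁ * #S₂ * #T₁ * #(Icc a b) := by
    rw [div_div, div_div, div_div, div_eq_iff (mul_pos hN₁0 (mul_pos hN₂0 (mul_pos hN₃0 hN0))).ne']
    ring
  rw [hX] at h₄
  refine ⟨l₁', hl₁', l₂', hl₂', m₁', hm₁', ?_⟩
  -- the inner geometric sums
  obtain ⟨x, hx⟩ : ∃ x : ℤ → ℤ → ℤ → ℝ, x = fun (l₁ l₂ m₁ : ℤ) =>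
    c * (l₁ - l₁') * (l₂ - l₂') * (m₁ - m₁') := ⟨_, rfl⟩
  obtain ⟨g, hg⟩ : ∃ g : (ℤ × ℤ) × ℤ → ℝ, g = fun p =>
    geomBound (#(Icc a b) : ℝ) (x p.1.1 p.1.2 p.2) := ⟨_, rfl⟩
  have hsum_le : κ * #S₁ * #S₂ * #T₁ * #(Icc a b) ≤ ∑ p ∈ (S₁ ×ˢ S₂) ×ˢ T₁, g p := by
    refine h₄.trans ((Complex.re_le_norm _).trans ?_)
    rw [Finset.sum_product, Finset.sum_product]
    refine (norm_sum_le _ _).trans (Finset.sum_le_sum fun l₁ _ => (norm_sum_le _ _).trans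
      (Finset.sum_le_sum fun l₂ _ => (norm_sum_le _ _).trans
        (Finset.sum_le_sum fun m₁ _ => ?_)))
    -- `∑_{m₂} e(x m₂ − x m₂') = e(−x m₂') ∑_{m₂} e(x m₂)`
    have hfac : ∑ m₂ ∈ Icc a b, Φ l₁ l₁' l₂ l₂' m₁ m₁' m₂ m₂' =
        (𝐞 (-(x l₁ l₂ m₁ * m₂')) : ℂ) * ∑ m₂ ∈ Icc a b, (𝐞 (x l₁ l₂ m₁ * m₂) : ℂ) := by
      rw [Finset.mul_sum]
      refine Finset.sum_congr rfl fun m₂ _ => ?_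
      rw [hΦ, hx]
      beta_reduce
      rw [← Circle.coe_mul, ← AddChar.map_add_eq_mul]
      congr 2
      ring
    rw [hfac, norm_mul, norm_fourierChar, one_mul, hg]
    exact norm_sum_Icc_int_fourierChar_le_geomBound hab _ (le_of_eq hNeq.symm)
  -- counting
  have hcount := card_filter_ge_of_sum_le ((S₁ ×ˢ S₂) ×ˢ T₁) g (θ := κ * #(Icc a b) / 2) hN0
    (by have := mul_pos hκ hN0; linarith) (fun p _ => by rw [hg]; exact geomBound_le _ _) hsum_le
  rw [Finset.card_product, Finset.card_product] at hcount
  push_cast at hcount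
  have hsimp : (κ * #S₁ * #S₂ * #T₁ * #(Icc a b) - κ * #(Icc a b) / 2 * (#S₁ * #S₂ * #T₁)) /
      (#(Icc a b) : ℝ) = κ / 2 * #S₁ * #S₂ * #T₁ := by
    rw [div_eq_iff hN0.ne']; ring
  rw [hsimp] at hcount
  refine hcount.trans ?_
  -- threshold on `geomBound` ⇒ small `distInt`
  have hmono : ((S₁ ×ˢ S₂) ×ˢ T₁).filter (fun p => κ * #(Icc a b) / 2 ≤ g p) ⊆
      ((S₁ ×ˢ S₂) ×ˢ T₁).filter (fun p =>
        distInt (c * (p.1.1 - l₁') * (p.1.2 - l₂') * (p.2 - m₁')) ≤ 1 / (κ * #(Icc a b))) := by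
    intro p hp
    rw [Finset.mem_filter] at hp ⊢
    refine ⟨hp.1, ?_⟩
    have hgp := hp.2
    rw [hg, hx] at hgp
    simp only at hgp
    have hκN : 0 < κ * (#(Icc a b) : ℝ) := mul_pos hκ hN0
    rcases (distInt_nonneg (c * (p.1.1 - l₁') * (p.1.2 - l₂') * (p.2 - m₁'))).eq_or_lt with hd | hd
    · rw [← hd]; exact div_nonneg zero_le_one hκN.le
    · have h1 := geomBound_le_inv (#(Icc a b) : ℝ) hd
      have h2 := hgp.trans h1
      have hd2 : (0 : ℝ) < 2 * distInt (c * (p.1.1 - l₁') * (p.1.2 - l₂') * (p.2 - m₁')) := by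
        linarith
      rw [le_div_iff₀ hd2] at h2
      rw [le_div_iff₀ hκN]
      nlinarith
  exact_mod_cast Finset.card_le_card hmono

end Summit.Parity.GeneralizedHardyLittlewood.GreenTaoLevelTwoMNTwoQuadrilinearCount
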